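import Mathlib
import Literature.Analysis.Fourier.HilbertTransformLineSkewAdjoint
import Literature.Analysis.Fourier.HilbertTransformLineSplit
import Literature.Analysis.Fourier.HilbertTransformDecay
import HarnessLib

/-!
# The half-line stretching pairing of an odd profile is nonpositive:
# `∫₀^∞ (HΩ)·Ω = −π⁻¹ ∫₀^∞ |𝓛Ω(s)|² ds ≤ 0` (Carleman / Laplace form)

HONEST FRAMING (cell ns-blowup GROUP B «PROFILE SEARCH», zone Z3 = the 1-D viscous gCLM/OSW sheet; human rulings
D-0035/D-0074): **a classical Hilbert-transform identity on the line, kernel-checked as the ONE nonlocal input of the sign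
laws of `SheetHalfLineIdentity` (MODEL side); not Euler, not Navier–Stokes.** Nothing here is a statement about NS.

WHAT IS PROVED. For `Ω : ℝ → ℝ` ODD, Lipschitz (`|Ω u − Ω v| ≤ K|u − v|`) and in `L¹ ∩ L²`, with `H = hilbertTransform`
(`Literature/Analysis/Fourier/HilbertTransformLine.lean`, convention `H[1/(1+y²)] = x/(1+x²)`, `u_x = Hω`):

* `integral_Ioi_hilbertTransform_mul_eq` — **`∫₀^∞ (HΩ)(x) Ω(x) dx = −π⁻¹ ∫₀^∞ Ω(x) (∫₀^∞ Ω(y)/(x+y) dy) dx`**.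
  Proof: cut `Ω⁺ = 𝟙_{(0,∞)}Ω` (Lipschitz since `Ω(0) = 0`), `Ω = Ω⁺ − Ω⁺(−·)`; `∫ Ω⁺·HΩ⁺ = 0` by the tree's skew-adjointness
  `integral_hilbertTransform_mul_eq_neg`; and for `x > 0` the transform of the reflected cut is the off-support integral
  `H[Ω⁺(−·)](x) = π⁻¹ ∫₀^∞ Ω(y)/(x+y) dy` (no principal value).
* `integral_Ioi_mul_carleman_eq` — **`∫₀^∞ Ω(x)∫₀^∞ Ω(y)/(x+y) dy dx = ∫₀^∞ F(s)² ds`, `F(s) = ∫₀^∞ Ω(y)e^{−sy} dy`** (write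
  `1/(x+y) = ∫₀^∞ e^{−s(x+y)} ds`, Fubini — the integrand is dominated by `|Ω(x)|·(K e^{1−y} + |Ω(y)|)` — and split the product),
  hence `integral_Ioi_mul_carleman_nonneg` (`≥ 0`) and
* `integral_Ioi_hilbertTransform_mul_nonpos` — **`∫₀^∞ (HΩ)·Ω ≤ 0`**: the hypothesis `hpair` of
  `SheetHalfLine.trivial_of_nonneg_on_Ioi` / `trivial_of_nonpos_on_Ioi` / `trivial_of_oneSigned_of_a_eq_neg_one` for the genuine
  Hilbert transform (the MODEL's `𝒰′ = HΩ`), which makes those sign laws unconditional for odd Lipschitz `L¹ ∩ L²` profiles.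
All statements are classical (the Carleman form `1/(x+y)` is the kernel of the Stieltjes/Laplace square; Hardy–Littlewood–Pólya,
*Inequalities*, Ch. IX; Córdoba–Córdoba–Fontelos 2005 use the same positivity for odd data); tagged [folklore]. No definitions.
bears_on: LADDER-NS N5 / zone Z3 clause (i′) (CENSUS-Z3 v2.2 §0) → N1 linear core. WHAT THIS IS NOT: not NS.
-/

noncomputable section
open Set Filter Topology MeasureTheory
open scoped Real

namespace Summit.NavierStokesRegularity.OSWSelfSimilar
namespace SheetHalfLine
open Literature.Analysis.Fourier

/-! ### The half-line cut `Ω⁺ = 𝟙_{(0,∞)} Ω` of a Lipschitz function with `Ω(0) = 0` -/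

/-- The cut `𝟙_{(0,∞)}Ω` of a `K`-Lipschitz `Ω` with `Ω(0) = 0` is `K`-Lipschitz on `ℝ`. [folklore] -/
theorem abs_cut_sub_cut_le {Om : ℝ → ℝ} {K : ℝ} (hK : 0 ≤ K) (hLip : ∀ u v, |Om u - Om v| ≤ K * |u - v|)
    (h0 : Om 0 = 0) (u v : ℝ) :
    |(Ioi (0:ℝ)).indicator Om u - (Ioi (0:ℝ)).indicator Om v| ≤ K * |u - v| := by
  have hin : ∀ {a : ℝ}, 0 < a → (Ioi (0:ℝ)).indicator Om a = Om a := fun ha => indicator_of_mem (mem_Ioi.mpr ha) _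
  have hout : ∀ {a : ℝ}, a ≤ 0 → (Ioi (0:ℝ)).indicator Om a = 0 := fun ha =>
    indicator_of_notMem (by simpa using ha) _
  have hK0 : ∀ {a : ℝ}, 0 < a → |Om a| ≤ K * a := fun {a} ha => by
    have h := hLip a 0
    rw [h0, sub_zero, sub_zero, abs_of_pos ha] at h
    exact h
  rcases le_or_gt u 0 with hu | hu <;> rcases le_or_gt v 0 with hv | hv
  · rw [hout hu, hout hv, sub_zero, abs_zero]; positivity
  · rw [hout hu, hin hv, zero_sub, abs_neg]
    have h1 := hK0 hv
    have h2 : v ≤ |u - v| := by rw [abs_sub_comm, abs_of_pos (by linarith)]; linarith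
    nlinarith
  · rw [hin hu, hout hv, sub_zero]
    have h1 := hK0 hu
    have h2 : u ≤ |u - v| := by rw [abs_of_pos (by linarith)]; linarith
    nlinarith
  · rw [hin hu, hin hv]; exact hLip u v

/-- The cut is continuous. [folklore] -/
theorem continuous_cut {Om : ℝ → ℝ} {K : ℝ} (hK : 0 ≤ K) (hLip : ∀ u v, |Om u - Om v| ≤ K * |u - v|)
    (h0 : Om 0 = 0) : Continuous ((Ioi (0:ℝ)).indicator Om) := by
  have hL : LipschitzWith (Real.toNNReal K) ((Ioi (0:ℝ)).indicator Om) :=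
    LipschitzWith.of_dist_le_mul fun u v => by
      rw [Real.dist_eq, Real.dist_eq, Real.coe_toNNReal _ hK]
      exact abs_cut_sub_cut_le hK hLip h0 u v
  exact hL.continuous

/-- The symmetric p.v. integrand of the cut is integrable on `(0,∞)` at every point (Lipschitz near piece, `L¹` far piece).
[folklore] -/
theorem integrableOn_symm_cut {Om : ℝ → ℝ} {K : ℝ} (hK : 0 ≤ K) (hLip : ∀ u v, |Om u - Om v| ≤ K * |u - v|)
    (h0 : Om 0 = 0) (hΩi : Integrable Om) (x : ℝ) :
    IntegrableOn (fun t => ((Ioi (0:ℝ)).indicator Om (x - t) - (Ioi (0:ℝ)).indicator Om (x + t)) / t) (Ioi 0) := by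
  have hgc := continuous_cut hK hLip h0
  have hgi : Integrable ((Ioi (0:ℝ)).indicator Om) := hΩi.indicator measurableSet_Ioi
  refine integrableOn_symmIntegrand ?_ ?_
  · exact integrableOn_near_Ioo hgc (M₂ := K) (ρ := 1) (fun u v => by rw [div_one]; exact abs_cut_sub_cut_le hK hLip h0 u v)
      one_pos hK x 1
  · have h1 : Integrable (fun u => (Ioi (0:ℝ)).indicator Om (x - u)) := hgi.comp_sub_left x
    refine Integrable.mono' (h1.norm.restrict)
      (((hgc.comp (continuous_sub_left x)).measurable.div measurable_id).aestronglyMeasurable) ?_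
    rw [ae_restrict_iff' (measurableSet_le_abs 1)]
    refine ae_of_all _ fun u hu => ?_
    have hu1 : (1:ℝ) ≤ |u| := hu
    rw [Real.norm_eq_abs, Real.norm_eq_abs, abs_div]
    exact div_le_self (abs_nonneg _) hu1

/-- For `x > 0` the shifted cut `t ↦ Ω⁺(t − x)/t` is integrable on `(0,∞)` (it vanishes for `t ≤ x`). [folklore] -/
theorem integrableOn_shift_cut {Om : ℝ → ℝ} {K : ℝ} (hK : 0 ≤ K) (hLip : ∀ u v, |Om u - Om v| ≤ K * |u - v|)
    (h0 : Om 0 = 0) (hΩi : Integrable Om) {x : ℝ} (hx : 0 < x) :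
    IntegrableOn (fun t => (Ioi (0:ℝ)).indicator Om (t - x) / t) (Ioi 0) := by
  have hgc := continuous_cut hK hLip h0
  have hgi : Integrable ((Ioi (0:ℝ)).indicator Om) := hΩi.indicator measurableSet_Ioi
  have h1 : Integrable (fun t => (Ioi (0:ℝ)).indicator Om (t - x)) := hgi.comp_sub_right x
  refine Integrable.mono' ((h1.norm.div_const x).restrict)
    (((hgc.comp (continuous_sub_right x)).measurable.div measurable_id).aestronglyMeasurable) ?_
  rw [ae_restrict_iff' measurableSet_Ioi]
  refine ae_of_all _ fun t ht => ?_
  have ht0 : 0 < t := ht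
  rcases le_or_gt t x with htx | htx
  · have hz : (Ioi (0:ℝ)).indicator Om (t - x) = 0 := indicator_of_notMem (by simp only [mem_Ioi, not_lt]; linarith) _
    simp [hz]
  · rw [Real.norm_eq_abs, Real.norm_eq_abs, abs_div, abs_of_pos ht0]
    exact div_le_div_of_nonneg_left (abs_nonneg _) hx htx.le

/-! ### The reflected cut has an off-support Hilbert transform on `(0,∞)` -/

/-- For `x > 0`: `H[Ω⁺(−·)](x) = π⁻¹ ∫₀^∞ Ω⁺(t − x)/t dt` (a plain integral: the support of `Ω⁺(−·)` is `(−∞,0]`).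
[folklore] -/
theorem hilbertTransform_reflect_cut {Om : ℝ → ℝ} {x : ℝ} (hx : 0 < x) :
    hilbertTransform (fun y => (Ioi (0:ℝ)).indicator Om (-y)) x
      = π⁻¹ * ∫ t in Ioi (0:ℝ), (Ioi (0:ℝ)).indicator Om (t - x) / t := by
  unfold hilbertTransform
  congr 1
  refine setIntegral_congr_fun measurableSet_Ioi fun t ht => ?_
  have ht0 : 0 < t := ht
  have hz : (Ioi (0:ℝ)).indicator Om (-(x + t)) = 0 :=
    indicator_of_notMem (by simp only [mem_Ioi, not_lt]; linarith) _
  simp only [neg_sub, hz, sub_zero]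

/-- For `x > 0`: `∫₀^∞ Ω⁺(t − x)/t dt = ∫₀^∞ Ω(y)/(x + y) dy` (translation `t = y + x`). [folklore] -/
theorem integral_shift_cut_eq {Om : ℝ → ℝ} {x : ℝ} (hx : 0 < x) :
    ∫ t in Ioi (0:ℝ), (Ioi (0:ℝ)).indicator Om (t - x) / t = ∫ y in Ioi (0:ℝ), Om y / (x + y) := by
  rw [← integral_indicator measurableSet_Ioi, ← integral_indicator measurableSet_Ioi,
    ← integral_add_right_eq_self ((Ioi (0:ℝ)).indicator fun t => (Ioi (0:ℝ)).indicator Om (t - x) / t) x]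
  refine integral_congr_ae (ae_of_all _ fun y => ?_)
  simp only
  rcases le_or_gt y 0 with hy | hy
  · have hR : (Ioi (0:ℝ)).indicator (fun y => Om y / (x + y)) y = 0 :=
      indicator_of_notMem (by simp only [mem_Ioi, not_lt]; exact hy) _
    have hzy : (Ioi (0:ℝ)).indicator Om y = 0 := indicator_of_notMem (by simp only [mem_Ioi, not_lt]; exact hy) _
    rw [hR]
    rcases le_or_gt (y + x) 0 with hyx | hyx
    · exact indicator_of_notMem (by simp only [mem_Ioi, not_lt]; exact hyx) _
    · rw [indicator_of_mem (mem_Ioi.mpr hyx), add_sub_cancel_right, hzy, zero_div]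
  · have hyx : 0 < y + x := by linarith
    rw [indicator_of_mem (mem_Ioi.mpr hyx), indicator_of_mem (mem_Ioi.mpr hy), add_sub_cancel_right,
      indicator_of_mem (mem_Ioi.mpr hy), add_comm y x]

/-! ### The Carleman form is a Laplace square -/

/-- Integrability of the Carleman integrand `Ω(x)Ω(y)/(x+y)` on the open quadrant `(0,∞)²` for `K`-Lipschitz `Ω ∈ L¹`
with `Ω(0) = 0` (dominated by `|Ω(x)|·(K e^{1−y} + |Ω(y)|)`). [folklore] -/
theorem integrable_carleman_kernel {Om : ℝ → ℝ} {K : ℝ} (hK : 0 ≤ K) (hLip : ∀ u v, |Om u - Om v| ≤ K * |u - v|)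
    (h0 : Om 0 = 0) (hΩi : Integrable Om) :
    Integrable (fun p : ℝ × ℝ => Om p.1 * Om p.2 / (p.1 + p.2))
      ((volume.restrict (Ioi (0:ℝ))).prod (volume.restrict (Ioi (0:ℝ)))) := by
  set μ : Measure ℝ := volume.restrict (Ioi (0:ℝ)) with hμ
  have hΩc : Continuous Om :=
    (LipschitzWith.of_dist_le_mul (K := Real.toNNReal K) (f := Om) fun u v => by
      rw [Real.dist_eq, Real.dist_eq, Real.coe_toNNReal _ hK]; exact hLip u v).continuous
  have hΩm : Measurable Om := hΩc.measurable
  have hquad : ∀ᵐ p ∂ μ.prod μ, 0 < p.1 ∧ 0 < p.2 := by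
    have hpr : μ.prod μ = (volume.prod volume).restrict (Ioi (0:ℝ) ×ˢ Ioi (0:ℝ)) := Measure.prod_restrict _ _
    rw [hpr]
    filter_upwards [ae_restrict_mem (measurableSet_Ioi.prod measurableSet_Ioi)] with p hp
    exact ⟨hp.1, hp.2⟩
  have hk_int : Integrable (fun y => K * (Real.exp 1 * Real.exp (-y)) + |Om y|) μ := by
    have h1 : IntegrableOn (fun y => Real.exp (-y)) (Ioi (0:ℝ)) := integrableOn_exp_neg_Ioi 0
    exact ((h1.const_mul (Real.exp 1)).const_mul K).add hΩi.abs.restrict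
  have hratio : ∀ y, 0 < y → |Om y| / y ≤ K * (Real.exp 1 * Real.exp (-y)) + |Om y| := by
    intro y hy
    have hKy : |Om y| ≤ K * y := by
      have h := hLip y 0
      rw [h0, sub_zero, sub_zero, abs_of_pos hy] at h
      exact h
    have hpos : 0 ≤ K * (Real.exp 1 * Real.exp (-y)) := by positivity
    rcases le_or_gt y 1 with hy1 | hy1
    · have h1 : |Om y| / y ≤ K := by rw [div_le_iff₀ hy]; exact hKy
      have h2 : (1:ℝ) ≤ Real.exp 1 * Real.exp (-y) := by
        rw [← Real.exp_add]
        exact Real.one_le_exp (by linarith)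
      have h3 : K ≤ K * (Real.exp 1 * Real.exp (-y)) := le_mul_of_one_le_right hK h2
      linarith [abs_nonneg (Om y)]
    · have h1 : |Om y| / y ≤ |Om y| := div_le_self (abs_nonneg _) hy1.le
      linarith
  have hΦm : AEStronglyMeasurable (fun p : ℝ × ℝ => Om p.1 * Om p.2 / (p.1 + p.2)) (μ.prod μ) :=
    (((hΩm.comp measurable_fst).mul (hΩm.comp measurable_snd)).div
      (measurable_fst.add measurable_snd)).aestronglyMeasurable
  refine Integrable.mono' ((hΩi.abs.restrict).mul_prod hk_int) hΦm ?_
  filter_upwards [hquad] with p hp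
  obtain ⟨hx, hy⟩ := hp
  rw [Real.norm_eq_abs, abs_div, abs_mul, abs_of_pos (by linarith : 0 < p.1 + p.2)]
  calc |Om p.1| * |Om p.2| / (p.1 + p.2) ≤ |Om p.1| * |Om p.2| / p.2 :=
        div_le_div_of_nonneg_left (by positivity) hy (by linarith)
    _ = |Om p.1| * (|Om p.2| / p.2) := by ring
    _ ≤ |Om p.1| * (K * (Real.exp 1 * Real.exp (-p.2)) + |Om p.2|) :=
        mul_le_mul_of_nonneg_left (hratio p.2 hy) (abs_nonneg _)

/-- **Carleman = Laplace square.** For `K`-Lipschitz `Ω ∈ L¹(ℝ)` with `Ω(0) = 0`: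
`∫₀^∞ Ω(x) (∫₀^∞ Ω(y)/(x+y) dy) dx = ∫₀^∞ F(s)·F(s) ds`, `F(s) = ∫₀^∞ Ω(y) e^{−sy} dy`.
(`1/(x+y) = ∫₀^∞ e^{−s(x+y)} ds`; Fubini is justified by the domination `|Ω(x)Ω(y)|/(x+y) ≤ |Ω(x)|·(|Ω(y)|/y)
≤ |Ω(x)|·(K e^{1−y} + |Ω(y)|)`.) [folklore] -/
theorem integral_Ioi_mul_carleman_eq {Om : ℝ → ℝ} {K : ℝ} (hK : 0 ≤ K) (hLip : ∀ u v, |Om u - Om v| ≤ K * |u - v|)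
    (h0 : Om 0 = 0) (hΩi : Integrable Om) :
    ∫ x in Ioi (0:ℝ), Om x * ∫ y in Ioi (0:ℝ), Om y / (x + y)
      = ∫ s in Ioi (0:ℝ), (∫ y in Ioi (0:ℝ), Om y * Real.exp (-(s * y))) * (∫ y in Ioi (0:ℝ), Om y * Real.exp (-(s * y))) := by
  set μ : Measure ℝ := volume.restrict (Ioi (0:ℝ)) with hμ
  have hΩc : Continuous Om :=
    (LipschitzWith.of_dist_le_mul (K := Real.toNNReal K) (f := Om) fun u v => by
      rw [Real.dist_eq, Real.dist_eq, Real.coe_toNNReal _ hK]; exact hLip u v).continuous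
  have hΩm : Measurable Om := hΩc.measurable
  -- a.e. on the product we are in the open quadrant
  have hquad : ∀ᵐ p ∂ μ.prod μ, 0 < p.1 ∧ 0 < p.2 := by
    have hpr : μ.prod μ = (volume.prod volume).restrict (Ioi (0:ℝ) ×ˢ Ioi (0:ℝ)) := Measure.prod_restrict _ _
    rw [hpr]
    filter_upwards [ae_restrict_mem (measurableSet_Ioi.prod measurableSet_Ioi)] with p hp
    exact ⟨hp.1, hp.2⟩
  have hΦ : Integrable (fun p : ℝ × ℝ => Om p.1 * Om p.2 / (p.1 + p.2)) (μ.prod μ) :=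
    integrable_carleman_kernel hK hLip h0 hΩi
  -- the iterated integral is the product integral
  have hJ : ∫ x in Ioi (0:ℝ), Om x * ∫ y in Ioi (0:ℝ), Om y / (x + y)
      = ∫ p, Om p.1 * Om p.2 / (p.1 + p.2) ∂(μ.prod μ) := by
    rw [integral_prod _ hΦ]
    refine integral_congr_ae (ae_of_all _ fun x => ?_)
    simp only
    rw [← integral_const_mul]
    refine integral_congr_ae (ae_of_all _ fun y => ?_)
    simp only
    ring
  -- 1/(x+y) as an exponential integral
  have hexp : ∀ x y : ℝ, 0 < x + y → ∫ s in Ioi (0:ℝ), Real.exp (-(x + y) * s) = 1 / (x + y) := by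
    intro x y hxy
    rw [integral_exp_mul_Ioi (by linarith : -(x + y) < 0) 0, mul_zero, Real.exp_zero, neg_div_neg_eq]
  -- the triple integrand
  set Ψ : ℝ × ℝ → ℝ → ℝ := fun p s => (Om p.1 * Real.exp (-(s * p.1))) * (Om p.2 * Real.exp (-(s * p.2))) with hΨ
  have hΨ_eq : ∀ p s, Ψ p s = Om p.1 * Om p.2 * Real.exp (-(p.1 + p.2) * s) := by
    intro p s
    simp only [hΨ]
    rw [show -(p.1 + p.2) * s = -(s * p.1) + -(s * p.2) by ring, Real.exp_add]
    ring
  have hΨ_int_s : ∀ p : ℝ × ℝ, 0 < p.1 → 0 < p.2 → ∫ s in Ioi (0:ℝ), Ψ p s = Om p.1 * Om p.2 / (p.1 + p.2) := by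
    intro p hx hy
    simp_rw [hΨ_eq]
    rw [integral_const_mul, hexp p.1 p.2 (by linarith)]
    ring
  have hΨ_norm_s : ∀ p : ℝ × ℝ, 0 < p.1 → 0 < p.2 →
      ∫ s in Ioi (0:ℝ), ‖Ψ p s‖ = ‖Om p.1 * Om p.2 / (p.1 + p.2)‖ := by
    intro p hx hy
    have hn : ∀ s, ‖Ψ p s‖ = |Om p.1 * Om p.2| * Real.exp (-(p.1 + p.2) * s) := by
      intro s
      rw [hΨ_eq, Real.norm_eq_abs, abs_mul, abs_of_pos (Real.exp_pos _)]
    simp_rw [hn]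
    rw [integral_const_mul, hexp p.1 p.2 (by linarith), Real.norm_eq_abs, abs_div,
      abs_of_pos (by linarith : 0 < p.1 + p.2)]
    ring
  -- integrability of the triple integrand on ((0,∞)²) × (0,∞)
  have hΨm : AEStronglyMeasurable (Function.uncurry Ψ) ((μ.prod μ).prod μ) := by
    have hm : Measurable (Function.uncurry Ψ) := by
      have e : Function.uncurry Ψ = fun q : (ℝ × ℝ) × ℝ =>
          (Om q.1.1 * Real.exp (-(q.2 * q.1.1))) * (Om q.1.2 * Real.exp (-(q.2 * q.1.2))) := by
        funext q; rfl
      rw [e]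
      exact ((hΩm.comp (measurable_fst.comp measurable_fst)).mul
          ((measurable_snd.mul (measurable_fst.comp measurable_fst)).neg.exp)).mul
        ((hΩm.comp (measurable_snd.comp measurable_fst)).mul
          ((measurable_snd.mul (measurable_snd.comp measurable_fst)).neg.exp))
    exact hm.aestronglyMeasurable
  have hΨi : Integrable (Function.uncurry Ψ) ((μ.prod μ).prod μ) := by
    rw [integrable_prod_iff hΨm]
    constructor
    · filter_upwards [hquad] with p hp
      obtain ⟨hx, hy⟩ := hp
      have h1 : IntegrableOn (fun s => Real.exp (-(p.1 + p.2) * s)) (Ioi (0:ℝ)) :=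
        exp_neg_integrableOn_Ioi 0 (by linarith)
      refine (h1.const_mul (Om p.1 * Om p.2)).congr (ae_of_all _ fun s => ?_)
      simp only [Function.uncurry_apply_pair]
      exact (hΨ_eq p s).symm
    · refine hΦ.norm.congr ?_
      filter_upwards [hquad] with p hp
      simp only [Function.uncurry_apply_pair]
      exact (hΨ_norm_s p hp.1 hp.2).symm
  have hswap : ∫ p, (∫ s, Ψ p s ∂μ) ∂(μ.prod μ) = ∫ s, (∫ p, Ψ p s ∂(μ.prod μ)) ∂μ :=
    integral_integral_swap hΨi
  have hprod : ∀ s, ∫ p, Ψ p s ∂(μ.prod μ)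
      = (∫ x, Om x * Real.exp (-(s * x)) ∂μ) * (∫ y, Om y * Real.exp (-(s * y)) ∂μ) := fun s =>
    integral_prod_mul (μ := μ) (ν := μ) (fun x => Om x * Real.exp (-(s * x))) (fun y => Om y * Real.exp (-(s * y)))
  calc ∫ x in Ioi (0:ℝ), Om x * ∫ y in Ioi (0:ℝ), Om y / (x + y)
      = ∫ p, Om p.1 * Om p.2 / (p.1 + p.2) ∂(μ.prod μ) := hJ
    _ = ∫ p, (∫ s, Ψ p s ∂μ) ∂(μ.prod μ) := by
        refine integral_congr_ae ?_
        filter_upwards [hquad] with p hp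
        exact (hΨ_int_s p hp.1 hp.2).symm
    _ = ∫ s, (∫ p, Ψ p s ∂(μ.prod μ)) ∂μ := hswap
    _ = ∫ s in Ioi (0:ℝ), (∫ y in Ioi (0:ℝ), Om y * Real.exp (-(s * y)))
          * (∫ y in Ioi (0:ℝ), Om y * Real.exp (-(s * y))) :=
        integral_congr_ae (ae_of_all _ fun s => hprod s)

/-- **The Carleman form is nonnegative**: `∫₀^∞ Ω(x)∫₀^∞ Ω(y)/(x+y) dy dx ≥ 0` for `K`-Lipschitz `Ω ∈ L¹` with `Ω(0) = 0`
(it is `∫₀^∞ F(s)² ds`). [folklore] -/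
theorem integral_Ioi_mul_carleman_nonneg {Om : ℝ → ℝ} {K : ℝ} (hK : 0 ≤ K) (hLip : ∀ u v, |Om u - Om v| ≤ K * |u - v|)
    (h0 : Om 0 = 0) (hΩi : Integrable Om) :
    0 ≤ ∫ x in Ioi (0:ℝ), Om x * ∫ y in Ioi (0:ℝ), Om y / (x + y) := by
  rw [integral_Ioi_mul_carleman_eq hK hLip h0 hΩi]
  exact setIntegral_nonneg measurableSet_Ioi fun s _ => mul_self_nonneg _

/-! ### The half-line stretching pairing -/

/-- **`∫₀^∞ (HΩ)·Ω = −π⁻¹ × (Carleman form)`** for odd, `K`-Lipschitz `Ω ∈ L¹ ∩ L²`: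
`∫₀^∞ (HΩ)(x)Ω(x) dx = −π⁻¹ ∫₀^∞ Ω(x) ∫₀^∞ Ω(y)/(x+y) dy dx`. [folklore] -/
theorem integral_Ioi_hilbertTransform_mul_eq {Om : ℝ → ℝ} {K : ℝ} (hodd : ∀ y, Om (-y) = -Om y) (hK : 0 ≤ K)
    (hLip : ∀ u v, |Om u - Om v| ≤ K * |u - v|) (hΩi : Integrable Om) (hΩ2 : MemLp Om 2) :
    ∫ x in Ioi (0:ℝ), hilbertTransform Om x * Om x
      = -(π⁻¹ * ∫ x in Ioi (0:ℝ), Om x * ∫ y in Ioi (0:ℝ), Om y / (x + y)) := by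
  have h0 : Om 0 = 0 := by
    have h := hodd 0
    rw [neg_zero] at h
    linarith
  set g : ℝ → ℝ := (Ioi (0:ℝ)).indicator Om with hg
  have hin : ∀ {a : ℝ}, 0 < a → g a = Om a := fun ha => indicator_of_mem (mem_Ioi.mpr ha) _
  have hout : ∀ {a : ℝ}, a ≤ 0 → g a = 0 := fun ha => indicator_of_notMem (by simpa using ha) _
  have hgi : Integrable g := hΩi.indicator measurableSet_Ioi
  have hg2 : MemLp g 2 := MemLp.indicator measurableSet_Ioi hΩ2
  have hsymm : ∀ x, IntegrableOn (fun t => (g (x - t) - g (x + t)) / t) (Ioi 0) :=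
    integrableOn_symm_cut hK hLip h0 hΩi
  -- the decomposition Ω = g − g(−·)
  have hΩfun : Om = fun y => g y + -g (-y) := by
    funext y
    rcases lt_trichotomy y 0 with hy | hy | hy
    · rw [hout hy.le, hin (by linarith : 0 < -y), hodd]; ring
    · subst hy; rw [h0, hout le_rfl, neg_zero, hout le_rfl]; ring
    · rw [hin hy, hout (by linarith : -y ≤ 0)]; ring
  -- (B2) the cut pairs to zero with its own transform
  have hB2 : ∫ x in Ioi (0:ℝ), hilbertTransform g x * Om x = 0 := by
    have hsk := integral_hilbertTransform_mul_eq_neg hgi hg2 hgi hg2 (ae_of_all _ hsymm) (ae_of_all _ hsymm)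
    have hcomm : ∫ x, g x * hilbertTransform g x = ∫ x, hilbertTransform g x * g x :=
      integral_congr_ae (ae_of_all _ fun x => mul_comm _ _)
    have hzero : ∫ x, hilbertTransform g x * g x = 0 := by linarith
    have hcut : ∫ x in Ioi (0:ℝ), hilbertTransform g x * Om x = ∫ x, hilbertTransform g x * g x := by
      rw [← integral_indicator measurableSet_Ioi]
      refine integral_congr_ae (ae_of_all _ fun x => ?_)
      exact indicator_mul_right (Ioi (0:ℝ)) (hilbertTransform g) Om
    rw [hcut, hzero]
  -- pointwise decomposition of (HΩ)Ω on (0,∞)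
  have hdec : EqOn (fun x => hilbertTransform Om x * Om x)
      (fun x => hilbertTransform g x * Om x - π⁻¹ * (Om x * ∫ y in Ioi (0:ℝ), Om y / (x + y))) (Ioi 0) := by
    intro x hx
    have hx0 : 0 < x := hx
    have hsn : IntegrableOn (fun t => (-g (-(x - t)) - -g (-(x + t))) / t) (Ioi 0) := by
      refine ((integrableOn_shift_cut hK hLip h0 hΩi hx0).neg).congr_fun (fun t ht => ?_) measurableSet_Ioi
      have ht0 : 0 < t := ht
      have hz : (Ioi (0:ℝ)).indicator Om (-(x + t)) = 0 := hout (by linarith)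
      simp only [Pi.neg_apply, neg_sub, hg, hz, neg_zero, sub_zero, neg_div]
    have e1 : hilbertTransform Om x = hilbertTransform (fun y => g y + -g (-y)) x := by rw [hΩfun]
    have e2 := hilbertTransform_add (f := g) (g := fun y => -g (-y)) (x := x) (hsymm x) hsn
    have e3 := hilbertTransform_neg (fun y => g (-y)) x
    have e4 := hilbertTransform_reflect_cut (Om := Om) hx0
    have e5 := integral_shift_cut_eq (Om := Om) hx0
    simp only
    rw [e1, e2, e3, e4, e5]
    ring
  -- integrability of the two pieces on (0,∞)
  have hi1 : IntegrableOn (fun x => hilbertTransform g x * Om x) (Ioi 0) :=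
    ((memLp_two_hilbertTransform hgi hg2 (ae_of_all _ hsymm)).integrable_mul hΩ2).integrableOn
  have hi2 : IntegrableOn (fun x => Om x * ∫ y in Ioi (0:ℝ), Om y / (x + y)) (Ioi 0) := by
    have hΦ := integrable_carleman_kernel hK hLip h0 hΩi
    have h := hΦ.integral_prod_left
    refine h.congr (ae_of_all _ fun x => ?_)
    simp only
    rw [← integral_const_mul]
    refine integral_congr_ae (ae_of_all _ fun y => ?_)
    simp only
    ring
  rw [setIntegral_congr_fun measurableSet_Ioi hdec, integral_sub hi1 (hi2.const_mul _), integral_const_mul, hB2,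
    zero_sub]

/-- **THE SIGN OF THE HALF-LINE STRETCHING PAIRING: `∫₀^∞ (HΩ)·Ω ≤ 0`** for odd, `K`-Lipschitz `Ω ∈ L¹ ∩ L²` — the
hypothesis `hpair` of the sign laws `SheetHalfLine.trivial_of_nonneg_on_Ioi` / `trivial_of_nonpos_on_Ioi` when the MODEL's
stretching is the genuine Hilbert transform `𝒰′ = HΩ`. [folklore] -/
theorem integral_Ioi_hilbertTransform_mul_nonpos {Om : ℝ → ℝ} {K : ℝ} (hodd : ∀ y, Om (-y) = -Om y) (hK : 0 ≤ K)
    (hLip : ∀ u v, |Om u - Om v| ≤ K * |u - v|) (hΩi : Integrable Om) (hΩ2 : MemLp Om 2) :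
    ∫ x in Ioi (0:ℝ), hilbertTransform Om x * Om x ≤ 0 := by
  have h0 : Om 0 = 0 := by
    have h := hodd 0
    rw [neg_zero] at h
    linarith
  rw [integral_Ioi_hilbertTransform_mul_eq hodd hK hLip hΩi hΩ2, neg_nonpos]
  exact mul_nonneg (by positivity) (integral_Ioi_mul_carleman_nonneg hK hLip h0 hΩi)

end SheetHalfLine
end Summit.NavierStokesRegularity.OSWSelfSimilar
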